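import Summits.QuantumFields.YangMills.Theorems.UnitScaleTiltProp7SectET3CurvedPropagatorsT3
import Summits.QuantumFields.YangMills.Theorems.UnitScaleTiltProp7SectET3BgClass
import Literature.MathematicalPhysics.QuantumFieldTheory.Balaban1983to89.B9CoReadingCoordsTranspose
import Literature.MathematicalPhysics.QuantumFieldTheory.Balaban1983to89.B9CoReadingCoordsH
import Literature.MathematicalPhysics.QuantumFieldTheory.Balaban1983to89.B9Thm312Whole
import HarnessLib

/-!
# Route `UnitScaleTilt` (α), node N06(d = 3), layer 0 — DEFINITIONS FILE, BRICK L0f: **THE LETTER RECORD `𝔬_T3` OF TRACK A's `B9Thm312Whole.Ops` AT THE T³ MEMBERS — ym-inputs-p01's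
# LAYER-0 LETTERS (three Hessian slots) READ BACK ON THE ROUTE CARRIERS AND PINNED TO pub-ymgap's κ-FOLD COORDINATE MODELS** (the T³ instance of `Lit/B9CoReadingCoords*` ∕
# `Node00.OpsYSectDCoords` §5, exactly the design of `Summits/…/BalabanUVNodesN06Thm312313AtPinsPairMB.lean`'s pins `hGco12`; memo `pub/ym-inputs/L0F-DEF-DESIGN-p05g2.md` §2∕§5)

Cell `ym-inputs` (D-0154 (2); desk `ym-inputs-plan-1` INPUT-LIST v8 §4 rows p01∕p05; DEFINER-MEMO-T3 §2 «L0f = `…SectET3OpsT3.lean`: `𝔬_T3 : ∀ i, Ops (geo9K i) (bgT3 i) X Y Z W`»;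
ym-inputs-p01's one-line GO 2026-08-28T11:12:27Z «L0f → p05 g2 GO … under DEFINER-MEMO names», desk fallback clause), seat ym-inputs-p05 g2 (typist; p01 = NAMER∕reviewer).
`--kind definition --supports stmt-QuantumFields-20520` (review lane; DEF-ONLY + `rfl`∕`dif_pos`∕`omega` glue, ★★OWNER ACK 32 (q3) pattern; the def-free rows are
`…SectET3OpsT3Rows.lean`); count-neutral; registry untouched; NOTHING of [Balaban1985BackgroundPropagators] is asserted; YM₃ on T³ is rung R3, NOT the Clay problem.

WHAT IS DEFINED (ns `…Theorems.Prop7SectET3OpsT3`; `i : KIdx 2 ℓ hd3 hL b₀ b₁` an index of def-Y's k-level census, `geo9K i`∕`bgT3 i` the record's geometry∕background carriers):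
* §1 THE INDEX DICTIONARY (memo §2 (d)): `nOf i := i.K + 1 − i.k` (the coarse height `n`; `= n` at `memberIdx … n K …` by `omega`, NOT `rfl`), `nOf_le : nOf i ≤ i.K`; the member family
  `FT3 i hm : T3Family := ⟨ℓ+1, hL, i.m, hm⟩` for `hm : 1 ≤ i.m` (`(FT3 i hm).P K′ = PV 2 ℓ i.m K′ hd3 hL` by `rfl`, ✓`FT3_P` — so the route carriers `PBond ((FT3 i hm).P i.K) 0 → M₂(ℂ)`
  ARE pub-ymgap's `FBondY i → M₂(ℂ)`); the retraction `cfgT3 : CfgV1 P (M₂ ℂ) → GaugeField P 0 SU(2)` (junk `1` off SU(2)-valued bond variables) with ✓`cfgT3_cfgV1OfT3 : cfgT3 (cfgV1OfT3 U₀) = U₀`.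
* §2 THE CARRIERS (memo §5 (c)): `X i = Y i := B9CoReadingCoords.XBK (TrIdx 2) i` (pub-ymgap's, cited not redefined), `ZT3 i := PBond (PV 2 ℓ i.m (nOf i) hd3 hL) 0 × Fin 3 × TrIdx 2 × TrIdx 2`
  (the route's block fields `PBond (F.P n) 0`, κ-fold — the «XHK-twin»), `WT3 i := Site (PV 2 ℓ i.m i.K hd3 hL) 0 × …` (gauge parameters, the «XSK-twin»).
* §3 ★★ `opsT3Pins i hm c₀ cB a Δ0 Δπ Δ1 bI bZ bW : Ops (geo9K i) (bgT3 i) (XBK (TrIdx 2) i) (XBK (TrIdx 2) i) (ZT3 i) (WT3 i)` — THE PINS (`Node00.OpsYSectDCoords` §5 shapes, `b := trBasis 2`,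
  `c := cR39 (trBasis 2)`, `K T := coordOpK b (fun _ ↦ T|_ℝ)`, `KH` two-carrier): `G0 := c•K(toL2⁻¹ GT[Δ0] toL2)`, `S0 := c⁻¹•K(toL2⁻¹ Δ_a[Δ0] toL2)`, `Tpi := c⁻¹•K(toL2⁻¹ (Δ0−Δπ) toL2)`,
  `T2 := c⁻¹•K(toL2⁻¹ (Δπ−Δ1) toL2)`, `G := c•K(… GT[Δπ] …)`, `G1`∕`GG := c•K(… GT[Δ1] ∕ frakGT[Δ1] …)`, `D`∕`Dstar := DcoK`∕`DscoK` (def-Y's covariant differences at `cfg := id` — the SAME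
  background carrier), `Q := c⁻¹•KH(toL2B⁻¹ Q_k toL2)`, `Qstar := c⁻¹•KH((c₀∕cB)•toL2⁻¹ Q_k† toL2B)` (print's two weights as one factor, so that `IsAdjTr 1 1` holds — ✓`…OpsT3CarrierRows.
  isAdjTr_one_readback_Qk`), `C`∕`C1 := c•K((cB∕c₀)•toL2B⁻¹ (QGQ*)⁻¹[Δπ∕Δ1] toL2B)`, `Hm`∕`H1m := c•KH(toL2⁻¹ HT[Δπ∕Δ1] toL2B)`, `Dv := KH(toL2⁻¹ D toL2S)`, `Dvstar := KH(toL2S⁻¹ D* toL2)`,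
  `R := c⁻¹•K(toL2S⁻¹ R_S toL2S)` (= p01's `RSPi`); block maps `blk = blkY := blkBK i bI`, `blkZ := bZ ∘ fst`, `blkW := bW ∘ fst` for DATA `bI bZ bW` (carrier-faithful index-bond maps,
  n06-l ✓`exists_carrierFaithful`; the knit supplies them); all letters at the background `cfgT3 V`, slots `Δ0 Δπ Δ1` DATA (the knit plugs ✓`DeltaEtaSlot`∕✓`DeltaPiSlot`∕✓`DeltaOne … TJ`).
* §4 `opsT3Junk` (zero operators, same carriers∕blocks) and ★★★ `opsT3 … : ∀ i,` (DEFINER-MEMO's `𝔬_T3`) Ops (geo9K i) (bgT3 i) (XBK (TrIdx 2) i) (XBK (TrIdx 2) i) (ZT3 i) (WT3 i) := if hm : 1 ≤ i.m then opsT3Pins i hm … else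
  opsT3Junk …` — the DEFINER-MEMO letter; ✓`opsT3_of_pos : opsT3 … i = opsT3Pins i hm …` (`dif_pos`).  The evaluation letters are pub-ymgap's `evBK i` (X and Y), NOT redefined.
LOCATED DESIGN CONSTRAINT (memo §2, p01 11:12:27Z (2∕2) chose (A)): at `i.m = 0` no `T3Family` exists, so `opsT3` is GENUINE exactly on `{i // 1 ≤ i.m}` and junk off it; the record's
∀-i analytic rows must be re-cut over that subtype (record lineage ∕ ★★OWNER) — this file does not hide the constraint, it displays it (`dite`).
HONEST SCOPE: definitions + `rfl`∕`dif_pos`∕`omega` glue; no estimate; positivity∕onto-ness (`PosOnto`), the slot facts and every analytic row are NOT here; `bI bZ bW`, the slots and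
`c₀ cB a` are data; print's `c₀ = η³` is member-dependent (here a parameter, as in bricks L0a–L0d); nothing continuum ∕ OS ∕ mass gap ∕ Clay.

References: T. Bałaban, CMP **99** (1985) 389–434 [Balaban1985BackgroundPropagators] ((3.26)–(3.27) p.395, (3.120)–(3.130) pp.419–421, (3.147) p.425, (3.153) p.426, (3.39)–(3.42) p.397);
CMP **96** (1984) 223–250 [Balaban1984PropagatorsII] ((2.45) p.231, (2.51) p.232); CMP **102** (1985) 277–309 [Balaban1985Variational] ((45) p.285, (110)–(111) p.294).
-/

set_option autoImplicit false

noncomputable section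

open scoped Matrix Matrix.Norms.L2Operator

namespace Summit.QuantumFields.YangMills.Theorems.Prop7SectET3OpsT3

open Literature.MathematicalPhysics.QuantumFieldTheory.Balaban1983to89
open Literature.MathematicalPhysics.QuantumFieldTheory.Balaban1983to89.T3ContinuumYM3Torus
open Literature.MathematicalPhysics.QuantumFieldTheory.Balaban1983to89.B9Thm312Whole (Ops)
open B6KLevelCensusIndexV1 (KIdx)
open B6GlobalChartV1 (PV)
open B9GeoNormsKLevelV1 (geo9K)
open B9BackgroundsKLevelV1 (CfgV1)
open B9Eq311L2Pairing (WL2)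
open B11Eq103H1Complex (BondL2K)
open B9CoReadingCoords (XBK blkBK coordOpK DcoK DscoK)
open B9CoReadingCoordsH (coordOpKH)
open B9CoReadingCoordsTranspose (TrIdx trBasis)
open B9Thm39ReadingCoords (cR39)
open Node00 (FBondY IBondY)
open Summit.QuantumFields.YangMills.Theorems.Prop7SectET3Members (hd3)
open Summit.QuantumFields.YangMills.Theorems.Prop7SectET3BgClass (bgT3 cfgV1OfT3 val_cfgV1OfT3)
open Summit.QuantumFields.YangMills.Theorems.Prop7SectET3Transport (periodsT3)
open Summit.QuantumFields.YangMills.Theorems.Prop7SectET3HilbertLetters (W₂ toL2 toL2S toL2B DL2 DstarL2)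
open Summit.QuantumFields.YangMills.Theorems.Prop7SectET3GaugeProjector (RS)
open Summit.QuantumFields.YangMills.Theorems.Prop7SectET3CurvedPropagators (Qk laplaceA GT KinvT HT frakGT)

variable {ℓ : ℕ} {hL : Odd (ℓ + 1) ∧ 1 < ℓ + 1} {b₀ b₁ : ℝ}

/-! ## §1 The index dictionary: coarse height, member family, retraction of configurations -/

/-- **THE COARSE HEIGHT `n` OF AN INDEX**: `nOf i := i.K + 1 − i.k` (`memberIdx … n K …` has `k = K − n + 1`, so `nOf = n` there by `omega`). [cite: Balaban1984PropagatorsII, (2.1)–(2.4) p.224 (dictionary)] -/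
def nOf (i : KIdx 2 ℓ hd3 hL b₀ b₁) : ℕ := i.K + 1 - i.k

/-- `nOf i ≤ i.K` (since `2 ≤ i.k`). [folklore] -/
theorem nOf_le (i : KIdx 2 ℓ hd3 hL b₀ b₁) : nOf i ≤ i.K := by
  have := i.hk2
  unfold nOf
  omega

/-- **THE T³ MEMBER FAMILY OF AN INDEX WITH `1 ≤ i.m`**: `⟨L, hL, m, hm⟩ = ⟨ℓ+1, hL, i.m, hm⟩`. [cite: Balaban1985Variational, p.278 (the family of tori), dictionary] -/
def FT3 (i : KIdx 2 ℓ hd3 hL b₀ b₁) (hm : 1 ≤ i.m) : T3Family := ⟨ℓ + 1, hL, i.m, hm⟩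

/-- The member family's `K′`-th lattice parameters ARE def-Y's `PV 2 ℓ i.m K′ hd3 hL` (by `rfl`): the route carriers at the member are pub-ymgap's `FBondY i`-type carriers.
[cite: Balaban1985Variational, p.278, dictionary] -/
theorem FT3_P (i : KIdx 2 ℓ hd3 hL b₀ b₁) (hm : 1 ≤ i.m) (K' : ℕ) : (FT3 i hm).P K' = PV 2 ℓ i.m K' hd3 hL := rfl

open Classical in
/-- **THE RETRACTION OF V1 CONFIGURATIONS ONTO THE ROUTE'S SU(2) FIELDS**: a bond variable in SU(2) is kept, any other is sent to `1` (junk; on the regular classes (3.35)–(3.36) every variable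
IS in SU(2)). [cite: Balaban1985BackgroundPropagators, p.396 («where U has values in G»), dictionary] -/
def cfgT3 {P : Params} (V : CfgV1 P (Matrix (Fin 2) (Fin 2) ℂ)) : GaugeField P 0 (Matrix.specialUnitaryGroup (Fin 2) ℂ) :=
  fun b => if h : ((V b.dir b.src : (Matrix (Fin 2) (Fin 2) ℂ)ˣ) : Matrix (Fin 2) (Fin 2) ℂ) ∈ Matrix.specialUnitaryGroup (Fin 2) ℂ then ⟨_, h⟩ else 1

/-- **THE RETRACTION INVERTS THE READING**: `cfgT3 (cfgV1OfT3 U₀) = U₀` — the letters below, at `V := cfgV1OfT3 U₀`, are print's letters at `U₀` on the nose. [cite: Balaban1985BackgroundPropagators, p.396, bookkeeping] -/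
theorem cfgT3_cfgV1OfT3 {P : Params} (U₀ : GaugeField P 0 (Matrix.specialUnitaryGroup (Fin 2) ℂ)) : cfgT3 (cfgV1OfT3 U₀) = U₀ := by
  funext b
  have hv : ((cfgV1OfT3 U₀ b.dir b.src : (Matrix (Fin 2) (Fin 2) ℂ)ˣ) : Matrix (Fin 2) (Fin 2) ℂ) = ((U₀ b : Matrix.specialUnitaryGroup (Fin 2) ℂ) : Matrix (Fin 2) (Fin 2) ℂ) :=
    val_cfgV1OfT3 U₀ b.dir b.src
  unfold cfgT3
  rw [dif_pos (by rw [hv]; exact (U₀ b).2)]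
  exact Subtype.ext hv

/-! ## §2 The carriers -/

/-- **THE BLOCK-FIELD CARRIER (the «XHK-twin»)**: the route's coarse bonds `PBond (F.P n) 0` at `n := nOf i`, κ-fold (`Fin 3` direction slots × output∕lift coordinates in `trBasis 2`).
[cite: Balaban1985BackgroundPropagators, (3.110) p.417 (B = QA on Λ_k), dictionary] -/
abbrev ZT3 (i : KIdx 2 ℓ hd3 hL b₀ b₁) : Type := PBond (PV 2 ℓ i.m (nOf i) hd3 hL) 0 × Fin (2 + 1) × TrIdx 2 × TrIdx 2

/-- **THE GAUGE-PARAMETER CARRIER (the «XSK-twin»)**: the route's fine sites, κ-fold. [cite: Balaban1985BackgroundPropagators, (3.21) p.394 (λ on T_η), dictionary] -/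
abbrev WT3 (i : KIdx 2 ℓ hd3 hL b₀ b₁) : Type := Site (PV 2 ℓ i.m i.K hd3 hL) 0 × Fin (2 + 1) × TrIdx 2 × TrIdx 2

/-! ## §3 The pinned letter record at an index with `1 ≤ i.m` -/

section Pins

variable (i : KIdx 2 ℓ hd3 hL b₀ b₁) (hm : 1 ≤ i.m) (c₀ cB a : ℝ) [Fact (0 < c₀)] [Fact (0 < cB)]
  (Δ0 Δπ Δ1 : GaugeField ((FT3 i hm).P i.K) 0 (Matrix.specialUnitaryGroup (Fin 2) ℂ) →
    (BondL2K ℂ 3 (periodsT3 (FT3 i hm) i.K) c₀ W₂ →ₗ[ℂ] BondL2K ℂ 3 (periodsT3 (FT3 i hm) i.K) c₀ W₂))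
  (bI : FBondY i → IBondY i) (bZ : PBond (PV 2 ℓ i.m (nOf i) hd3 hL) 0 → IBondY i) (bW : Site (PV 2 ℓ i.m i.K hd3 hL) 0 → IBondY i)

/-- ★★ **THE PINNED LETTER RECORD AT AN INDEX** (see the module docstring §3 for the dictionary field by field). [cite: Balaban1985BackgroundPropagators, (3.26)–(3.27) p.395, (3.120)–(3.130) pp.419–421, (3.147) p.425, (3.153) p.426; Balaban1984PropagatorsII, (2.51) p.232] -/
def opsT3Pins : Ops (geo9K i) (bgT3 i) (XBK (TrIdx 2) i) (XBK (TrIdx 2) i) (ZT3 i) (WT3 i) where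
  blk := blkBK i bI
  blkY := blkBK i bI
  blkZ := fun p => bZ p.1
  blkW := fun p => bW p.1
  G0 := fun V => cR39 (trBasis 2) • coordOpK (trBasis 2) (fun _ : Fin (2 + 1) =>
    ((toL2 (FT3 i hm) i.K c₀).symm.toLinearMap ∘ₗ GT (FT3 i hm) (nOf i) i.K (nOf_le i) c₀ cB a Δ0 (cfgT3 V) ∘ₗ (toL2 (FT3 i hm) i.K c₀).toLinearMap).restrictScalars ℝ)
  S0 := fun V => (cR39 (trBasis 2))⁻¹ • coordOpK (trBasis 2) (fun _ : Fin (2 + 1) =>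
    ((toL2 (FT3 i hm) i.K c₀).symm.toLinearMap ∘ₗ laplaceA (FT3 i hm) (nOf i) i.K (nOf_le i) c₀ cB a Δ0 (cfgT3 V) ∘ₗ (toL2 (FT3 i hm) i.K c₀).toLinearMap).restrictScalars ℝ)
  Tpi := fun V => (cR39 (trBasis 2))⁻¹ • coordOpK (trBasis 2) (fun _ : Fin (2 + 1) =>
    ((toL2 (FT3 i hm) i.K c₀).symm.toLinearMap ∘ₗ (Δ0 (cfgT3 V) - Δπ (cfgT3 V)) ∘ₗ (toL2 (FT3 i hm) i.K c₀).toLinearMap).restrictScalars ℝ)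
  T2 := fun V => (cR39 (trBasis 2))⁻¹ • coordOpK (trBasis 2) (fun _ : Fin (2 + 1) =>
    ((toL2 (FT3 i hm) i.K c₀).symm.toLinearMap ∘ₗ (Δπ (cfgT3 V) - Δ1 (cfgT3 V)) ∘ₗ (toL2 (FT3 i hm) i.K c₀).toLinearMap).restrictScalars ℝ)
  G := fun V => cR39 (trBasis 2) • coordOpK (trBasis 2) (fun _ : Fin (2 + 1) =>
    ((toL2 (FT3 i hm) i.K c₀).symm.toLinearMap ∘ₗ GT (FT3 i hm) (nOf i) i.K (nOf_le i) c₀ cB a Δπ (cfgT3 V) ∘ₗ (toL2 (FT3 i hm) i.K c₀).toLinearMap).restrictScalars ℝ)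
  G1 := fun V => cR39 (trBasis 2) • coordOpK (trBasis 2) (fun _ : Fin (2 + 1) =>
    ((toL2 (FT3 i hm) i.K c₀).symm.toLinearMap ∘ₗ GT (FT3 i hm) (nOf i) i.K (nOf_le i) c₀ cB a Δ1 (cfgT3 V) ∘ₗ (toL2 (FT3 i hm) i.K c₀).toLinearMap).restrictScalars ℝ)
  GG := fun V => cR39 (trBasis 2) • coordOpK (trBasis 2) (fun _ : Fin (2 + 1) =>
    ((toL2 (FT3 i hm) i.K c₀).symm.toLinearMap ∘ₗ frakGT (FT3 i hm) (nOf i) i.K (nOf_le i) c₀ cB a Δ1 (cfgT3 V) ∘ₗ (toL2 (FT3 i hm) i.K c₀).toLinearMap).restrictScalars ℝ)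
  D := fun V => DcoK i (trBasis 2) (bgT3 i) (fun V => V) V
  Dstar := fun V => DscoK i (trBasis 2) (bgT3 i) (fun V => V) V
  Q := fun V => (cR39 (trBasis 2))⁻¹ • coordOpKH (trBasis 2) (fun _ : Fin (2 + 1) =>
    ((toL2B (FT3 i hm) (nOf i) cB).symm.toLinearMap ∘ₗ Qk (FT3 i hm) (nOf i) i.K (nOf_le i) c₀ cB (cfgT3 V) ∘ₗ (toL2 (FT3 i hm) i.K c₀).toLinearMap).restrictScalars ℝ)
  Qstar := fun V => (cR39 (trBasis 2))⁻¹ • coordOpKH (trBasis 2) (fun _ : Fin (2 + 1) =>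
    ((((c₀ / cB : ℝ) : ℂ)) • ((toL2 (FT3 i hm) i.K c₀).symm.toLinearMap ∘ₗ LinearMap.adjoint (Qk (FT3 i hm) (nOf i) i.K (nOf_le i) c₀ cB (cfgT3 V)) ∘ₗ
      (toL2B (FT3 i hm) (nOf i) cB).toLinearMap)).restrictScalars ℝ)
  C := fun V => cR39 (trBasis 2) • coordOpK (trBasis 2) (fun _ : Fin (2 + 1) =>
    ((((cB / c₀ : ℝ) : ℂ)) • ((toL2B (FT3 i hm) (nOf i) cB).symm.toLinearMap ∘ₗ KinvT (FT3 i hm) (nOf i) i.K (nOf_le i) c₀ cB a Δπ (cfgT3 V) ∘ₗ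
      (toL2B (FT3 i hm) (nOf i) cB).toLinearMap)).restrictScalars ℝ)
  C1 := fun V => cR39 (trBasis 2) • coordOpK (trBasis 2) (fun _ : Fin (2 + 1) =>
    ((((cB / c₀ : ℝ) : ℂ)) • ((toL2B (FT3 i hm) (nOf i) cB).symm.toLinearMap ∘ₗ KinvT (FT3 i hm) (nOf i) i.K (nOf_le i) c₀ cB a Δ1 (cfgT3 V) ∘ₗ
      (toL2B (FT3 i hm) (nOf i) cB).toLinearMap)).restrictScalars ℝ)
  Hm := fun V => cR39 (trBasis 2) • coordOpKH (trBasis 2) (fun _ : Fin (2 + 1) =>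
    ((toL2 (FT3 i hm) i.K c₀).symm.toLinearMap ∘ₗ HT (FT3 i hm) (nOf i) i.K (nOf_le i) c₀ cB a Δπ (cfgT3 V) ∘ₗ (toL2B (FT3 i hm) (nOf i) cB).toLinearMap).restrictScalars ℝ)
  H1m := fun V => cR39 (trBasis 2) • coordOpKH (trBasis 2) (fun _ : Fin (2 + 1) =>
    ((toL2 (FT3 i hm) i.K c₀).symm.toLinearMap ∘ₗ HT (FT3 i hm) (nOf i) i.K (nOf_le i) c₀ cB a Δ1 (cfgT3 V) ∘ₗ (toL2B (FT3 i hm) (nOf i) cB).toLinearMap).restrictScalars ℝ)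
  Dv := fun V => coordOpKH (trBasis 2) (fun _ : Fin (2 + 1) =>
    ((toL2 (FT3 i hm) i.K c₀).symm.toLinearMap ∘ₗ DL2 (FT3 i hm) (nOf i) i.K c₀ (cfgT3 V) ∘ₗ (toL2S (FT3 i hm) i.K c₀).toLinearMap).restrictScalars ℝ)
  Dvstar := fun V => coordOpKH (trBasis 2) (fun _ : Fin (2 + 1) =>
    ((toL2S (FT3 i hm) i.K c₀).symm.toLinearMap ∘ₗ DstarL2 (FT3 i hm) (nOf i) i.K c₀ (cfgT3 V) ∘ₗ (toL2 (FT3 i hm) i.K c₀).toLinearMap).restrictScalars ℝ)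
  R := fun V => (cR39 (trBasis 2))⁻¹ • coordOpK (trBasis 2) (fun _ : Fin (2 + 1) =>
    ((toL2S (FT3 i hm) i.K c₀).symm.toLinearMap ∘ₗ RS (FT3 i hm) (nOf i) i.K (nOf_le i) c₀ cB (cfgT3 V) ∘ₗ (toL2S (FT3 i hm) i.K c₀).toLinearMap).restrictScalars ℝ)

end Pins

/-! ## §4 The junk record off `1 ≤ i.m` and the DEFINER-MEMO letter `𝔬_T3` (here `opsT3`) -/

/-- the record with all operator letters `0` (used only off `1 ≤ i.m`, where no T³ member exists — memo §2; the analytic rows must exclude these indices).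
[cite: Balaban1985BackgroundPropagators, p.396, dictionary (junk)] -/
def opsT3Junk (i : KIdx 2 ℓ hd3 hL b₀ b₁) (bI : FBondY i → IBondY i) (bZ : PBond (PV 2 ℓ i.m (nOf i) hd3 hL) 0 → IBondY i)
    (bW : Site (PV 2 ℓ i.m i.K hd3 hL) 0 → IBondY i) : Ops (geo9K i) (bgT3 i) (XBK (TrIdx 2) i) (XBK (TrIdx 2) i) (ZT3 i) (WT3 i) where
  blk := blkBK i bI
  blkY := blkBK i bI
  blkZ := fun p => bZ p.1
  blkW := fun p => bW p.1
  G0 := fun _ => 0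
  S0 := fun _ => 0
  Tpi := fun _ => 0
  T2 := fun _ => 0
  G := fun _ => 0
  G1 := fun _ => 0
  GG := fun _ => 0
  D := fun _ => 0
  Dstar := fun _ => 0
  Q := fun _ => 0
  Qstar := fun _ => 0
  C := fun _ => 0
  C1 := fun _ => 0
  Hm := fun _ => 0
  H1m := fun _ => 0
  Dv := fun _ => 0
  Dvstar := fun _ => 0
  R := fun _ => 0

section OpsT3

variable (c₀ cB a : ℝ) [Fact (0 < c₀)] [Fact (0 < cB)]
  (Δ0 Δπ Δ1 : ∀ (i : KIdx 2 ℓ hd3 hL b₀ b₁) (hm : 1 ≤ i.m), GaugeField ((FT3 i hm).P i.K) 0 (Matrix.specialUnitaryGroup (Fin 2) ℂ) →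
    (BondL2K ℂ 3 (periodsT3 (FT3 i hm) i.K) c₀ W₂ →ₗ[ℂ] BondL2K ℂ 3 (periodsT3 (FT3 i hm) i.K) c₀ W₂))
  (bI : ∀ i : KIdx 2 ℓ hd3 hL b₀ b₁, FBondY i → IBondY i) (bZ : ∀ i : KIdx 2 ℓ hd3 hL b₀ b₁, PBond (PV 2 ℓ i.m (nOf i) hd3 hL) 0 → IBondY i)
  (bW : ∀ i : KIdx 2 ℓ hd3 hL b₀ b₁, Site (PV 2 ℓ i.m i.K hd3 hL) 0 → IBondY i)

/-- ★★★ **`opsT3` (DEFINER-MEMO-T3's `𝔬_T3`; ASCII name for the gate's tooling) — THE LETTER RECORD OF THE N06(d = 3) LEAVES AT THE T³ MEMBERS** (DEFINER-MEMO-T3 §2 L0f): the pinned record `opsT3Pins` at every index with `1 ≤ i.m`, the zero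
record off it (no T³ member there — memo `L0F-DEF-DESIGN-p05g2.md` §2, option (A)). [cite: Balaban1985BackgroundPropagators, (3.120)–(3.153) pp.419–426] -/
def opsT3 (i : KIdx 2 ℓ hd3 hL b₀ b₁) : Ops (geo9K i) (bgT3 i) (XBK (TrIdx 2) i) (XBK (TrIdx 2) i) (ZT3 i) (WT3 i) :=
  if hm : 1 ≤ i.m then opsT3Pins i hm c₀ cB a (Δ0 i hm) (Δπ i hm) (Δ1 i hm) (bI i) (bZ i) (bW i) else opsT3Junk i (bI i) (bZ i) (bW i)

variable {c₀ cB a Δ0 Δπ Δ1 bI bZ bW}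

/-- On `1 ≤ i.m` the record IS the pinned record. [folklore] -/
theorem opsT3_of_pos {i : KIdx 2 ℓ hd3 hL b₀ b₁} (hm : 1 ≤ i.m) :
    opsT3 c₀ cB a Δ0 Δπ Δ1 bI bZ bW i = opsT3Pins i hm c₀ cB a (Δ0 i hm) (Δπ i hm) (Δ1 i hm) (bI i) (bZ i) (bW i) := dif_pos hm

/-- Off `1 ≤ i.m` the record is the junk record. [folklore] -/
theorem opsT3_of_not {i : KIdx 2 ℓ hd3 hL b₀ b₁} (hm : ¬ 1 ≤ i.m) : opsT3 c₀ cB a Δ0 Δπ Δ1 bI bZ bW i = opsT3Junk i (bI i) (bZ i) (bW i) := dif_neg hm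

end OpsT3

end Summit.QuantumFields.YangMills.Theorems.Prop7SectET3OpsT3

end
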